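import Mathlib
import HarnessLib
import Summits.Ventures.LatticeQCDFlow.Exactness.SU2ExactForceTransplant
import Summits.Ventures.LatticeQCDFlow.Exactness.SU2WilsonFlowLOExactForceRegular

/-!
# VOLUME-FREE CONSTANTS: the exact force through the `SU(2)` LO Wilson-flow member is bounded and Lipschitz with constants that do NOT depend on the lattice side

HONEST FRAMING: exact (Metropolis-corrected) sampling algorithms for lattice gauge theory;
figures of merit are autocorrelation/cost numbers at stated couplings and volumes; no
continuum-physics claim.

Venture `LatticeQCDFlow` (cell pub-lqcd), topic `Exactness`; FANOUT row 14 (`eng-flowhmc`, engine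
`latflow.fthmc`, family B: FT-HMC through the LO Wilson-flow member on `SU(2)` with the exact autodiff
force, row 9's `n`-step Pauli-drift kernel `su2LeapfrogHMCN`).  NEW WORK of the cell over the tree
(`SU2ExactForceTransplant`: the force at a link of the `L`-torus is the force on a fixed reference torus
at a transplanted field, the transplant is `1`-Lipschitz; `SU2WilsonFlowLOExactForceRegular` (GEN-14):
`Φ_max`, `K_Φ` on ONE torus by compactness; `LatticeForceVolumeUniform`: `phaseMask_proper`, `phaseMask_pull`); nothing is cited as a fact; no number.
The REGULARITY HALF of the ninth file of the VOLUME-UNIFORMITY chain (GEN-15), split off (GEN-17) because it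
needs neither the member package nor the convergence machinery — only the transplant and ONE-torus
compactness; it CLOSES the NOT-CLAIMED item of GEN-14 (`SU2WilsonFlowLOExactForceRegular`: "constants
uniform in the volume"); the convergence half is `SU2ExactForceVolumeUniform`.  Masks = the engine's phase masks `x ↦ Σᵢ xᵢ mod w` (`w ∣ L`; parity:
`w = 2`), written VERBATIM as `ZMod.castHom hwL (ZMod w) (∑ j, x j)`.

* (`LatticeForceVolumeUniform`: `phaseMask_proper` (`w > 1`), `phaseMask_pull` — phase masks are
  compatible with every covering `ℤ/M → ℤ/L`, `L ∣ M`);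
* §1 **`su2WilsonFlowLO_exactForce_regular_uniform`** — for the schedule `sched` of phase-masked LO
  sub-steps (`2(d−1)|ε| < 1`), every `β, κ`: THERE ARE `Φ_max, K_Φ ≥ 0` SUCH THAT FOR EVERY SIDE `L` with
  `w ∣ L` and every `layers` packaged VERBATIM as in `exists_layers_su2WilsonFlowLO` (positive densities)
  the exact force is measurable, `‖Φ_κ(V)_l‖ ≤ Φ_max`, `‖Φ_κ(V) − Φ_κ(V')‖ ≤ K_Φ‖V − V'‖_∞`;
NOT CLAIMED: the values of `Φ_max`, `K_Φ` (compactness on the reference torus of side `w(4K+5)`; no number);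
FT-HMC convergence (the sequel); the learned residual members (`SU2ResidualExactForceRegularUniform`); floating point.
-/

noncomputable section

namespace Summit.Ventures.LatticeQCDFlow.Exactness

open Set Function MeasureTheory ProbabilityTheory ProbabilityTheory.Kernel InnerProductGeometry WithLp NormedSpace
open Literature.MathematicalPhysics.QuantumFieldTheory
open Literature.MathematicalPhysics.QuantumFieldTheory.Balaban1983to89.B10Eq18SigmaSU2Haar (expPauli)
open scoped ENNReal Matrix Matrix.Norms.Operator NNReal

set_option backward.isDefEq.respectTransparency false

/-! ## §1 The exact force through the LO member: constants uniform in the volume -/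

section Uniform

variable {d : ℕ}

/-- **THE EXACT FORCE THROUGH THE `SU(2)` LO MEMBER IS BOUNDED AND LIPSCHITZ UNIFORMLY IN THE VOLUME.**
Phase masks of width `w > 1`, refusal rule `2(d−1)|ε| < 1`, ANY schedule `sched`, every `β, κ`: there are
`Φ_max, K_Φ ≥ 0` such that FOR EVERY side `L` with `w ∣ L` and every `layers` packaged VERBATIM as in
`exists_layers_su2WilsonFlowLO` with positive densities, the exact force is measurable,
`‖Φ_κ(V)_l‖ ≤ Φ_max` and `‖Φ_κ(V) − Φ_κ(V')‖ ≤ K_Φ‖coeConfig V − coeConfig V'‖`.  (`Φ_max`, `K_Φ` are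
GEN-14's compactness constants on the reference torus of side `w(4K+5)`, `K = sched.length`.) -/
theorem su2WilsonFlowLO_exactForce_regular_uniform (w : ℕ) [Fact (1 < w)] {ε : ℝ}
    (hε : |ε| * (2 * ((d - 1 : ℕ) : ℝ)) < 1) (sched : List (Fin d × ZMod w)) (β κ : ℝ) :
    ∃ Φmax KΦ : ℝ, 0 ≤ Φmax ∧ 0 ≤ KΦ ∧ ∀ (L : ℕ) [NeZero L] (hwL : w ∣ L)
      (layers : List ((GaugeConfig d L (Matrix.specialUnitaryGroup (Fin 2) ℂ) ≃ᵐ GaugeConfig d L (Matrix.specialUnitaryGroup (Fin 2) ℂ)) × (GaugeConfig d L (Matrix.specialUnitaryGroup (Fin 2) ℂ) → ℝ)))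
      (_hmap :
        layers.map (fun Ly => ((Ly.1 : GaugeConfig d L (Matrix.specialUnitaryGroup (Fin 2) ℂ) → GaugeConfig d L (Matrix.specialUnitaryGroup (Fin 2) ℂ)), Ly.2)) =
        sched.map (fun s =>
        ((fun (V : GaugeConfig d L (Matrix.specialUnitaryGroup (Fin 2) ℂ)) (e : Edge d L) =>
        if e.2 = s.1 ∧ (ZMod.castHom hwL (ZMod w) (∑ j, e.1 j)) = s.2 then
          gaussUnit (geodesicKick ε (∑ ν ∈ Finset.univ.erase e.2,
            (vecQuat (((V (Site.shift e.1 e.2, ν) * (V (Site.shift e.1 ν, e.2))⁻¹ * (V (e.1, ν))⁻¹)⁻¹ : (Matrix.specialUnitaryGroup (Fin 2) ℂ)) : Matrix (Fin 2) (Fin 2) ℂ) +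
              vecQuat ((((V (Site.shift (e.1 - Pi.single ν 1) e.2, ν))⁻¹ * (V (e.1 - Pi.single ν 1, e.2))⁻¹ *
                V (e.1 - Pi.single ν 1, ν))⁻¹ : (Matrix.specialUnitaryGroup (Fin 2) ℂ)) : Matrix (Fin 2) (Fin 2) ℂ)))
            (vecQuat ((V e : (Matrix.specialUnitaryGroup (Fin 2) ℂ)) : Matrix (Fin 2) (Fin 2) ℂ)))
        else V e),
         fun V : GaugeConfig d L (Matrix.specialUnitaryGroup (Fin 2) ℂ) => ∏ a : {e : Edge d L // e.2 = s.1 ∧ (ZMod.castHom hwL (ZMod w) (∑ j, e.1 j)) = s.2},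
          (if Real.sin (angle (∑ ν ∈ Finset.univ.erase a.1.2,
            (vecQuat (((V (Site.shift a.1.1 a.1.2, ν) * (V (Site.shift a.1.1 ν, a.1.2))⁻¹ * (V (a.1.1, ν))⁻¹)⁻¹ : (Matrix.specialUnitaryGroup (Fin 2) ℂ)) : Matrix (Fin 2) (Fin 2) ℂ) +
              vecQuat ((((V (Site.shift (a.1.1 - Pi.single ν 1) a.1.2, ν))⁻¹ * (V (a.1.1 - Pi.single ν 1, a.1.2))⁻¹ *
                V (a.1.1 - Pi.single ν 1, ν))⁻¹ : (Matrix.specialUnitaryGroup (Fin 2) ℂ)) : Matrix (Fin 2) (Fin 2) ℂ))) (vecQuat ((V a.1 : (Matrix.specialUnitaryGroup (Fin 2) ℂ)) : Matrix (Fin 2) (Fin 2) ℂ))) = 0 then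
            (1 - ε * ‖(∑ ν ∈ Finset.univ.erase a.1.2,
            (vecQuat (((V (Site.shift a.1.1 a.1.2, ν) * (V (Site.shift a.1.1 ν, a.1.2))⁻¹ * (V (a.1.1, ν))⁻¹)⁻¹ : (Matrix.specialUnitaryGroup (Fin 2) ℂ)) : Matrix (Fin 2) (Fin 2) ℂ) +
              vecQuat ((((V (Site.shift (a.1.1 - Pi.single ν 1) a.1.2, ν))⁻¹ * (V (a.1.1 - Pi.single ν 1, a.1.2))⁻¹ *
                V (a.1.1 - Pi.single ν 1, ν))⁻¹ : (Matrix.specialUnitaryGroup (Fin 2) ℂ)) : Matrix (Fin 2) (Fin 2) ℂ)))‖ * Real.cos (angle (∑ ν ∈ Finset.univ.erase a.1.2,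
            (vecQuat (((V (Site.shift a.1.1 a.1.2, ν) * (V (Site.shift a.1.1 ν, a.1.2))⁻¹ * (V (a.1.1, ν))⁻¹)⁻¹ : (Matrix.specialUnitaryGroup (Fin 2) ℂ)) : Matrix (Fin 2) (Fin 2) ℂ) +
              vecQuat ((((V (Site.shift (a.1.1 - Pi.single ν 1) a.1.2, ν))⁻¹ * (V (a.1.1 - Pi.single ν 1, a.1.2))⁻¹ *
                V (a.1.1 - Pi.single ν 1, ν))⁻¹ : (Matrix.specialUnitaryGroup (Fin 2) ℂ)) : Matrix (Fin 2) (Fin 2) ℂ))) (vecQuat ((V a.1 : (Matrix.specialUnitaryGroup (Fin 2) ℂ)) : Matrix (Fin 2) (Fin 2) ℂ)))) ^ 3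
          else kickJac (ε * ‖(∑ ν ∈ Finset.univ.erase a.1.2,
            (vecQuat (((V (Site.shift a.1.1 a.1.2, ν) * (V (Site.shift a.1.1 ν, a.1.2))⁻¹ * (V (a.1.1, ν))⁻¹)⁻¹ : (Matrix.specialUnitaryGroup (Fin 2) ℂ)) : Matrix (Fin 2) (Fin 2) ℂ) +
              vecQuat ((((V (Site.shift (a.1.1 - Pi.single ν 1) a.1.2, ν))⁻¹ * (V (a.1.1 - Pi.single ν 1, a.1.2))⁻¹ *
                V (a.1.1 - Pi.single ν 1, ν))⁻¹ : (Matrix.specialUnitaryGroup (Fin 2) ℂ)) : Matrix (Fin 2) (Fin 2) ℂ)))‖) 2 (angle (∑ ν ∈ Finset.univ.erase a.1.2,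
            (vecQuat (((V (Site.shift a.1.1 a.1.2, ν) * (V (Site.shift a.1.1 ν, a.1.2))⁻¹ * (V (a.1.1, ν))⁻¹)⁻¹ : (Matrix.specialUnitaryGroup (Fin 2) ℂ)) : Matrix (Fin 2) (Fin 2) ℂ) +
              vecQuat ((((V (Site.shift (a.1.1 - Pi.single ν 1) a.1.2, ν))⁻¹ * (V (a.1.1 - Pi.single ν 1, a.1.2))⁻¹ *
                V (a.1.1 - Pi.single ν 1, ν))⁻¹ : (Matrix.specialUnitaryGroup (Fin 2) ℂ)) : Matrix (Fin 2) (Fin 2) ℂ))) (vecQuat ((V a.1 : (Matrix.specialUnitaryGroup (Fin 2) ℂ)) : Matrix (Fin 2) (Fin 2) ℂ)))))))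
      (_hpos : ∀ Ly ∈ layers, ∀ V, 0 < Ly.2 V),
      Measurable (fun (V : GaugeConfig d L (Matrix.specialUnitaryGroup (Fin 2) ℂ)) (l : Edge d L) => κ • WithLp.toLp 2 (fun i : Fin 3 =>
        fderiv ℝ (fun a : Edge d L → EuclideanSpace ℝ (Fin 3) => β * wilsonAction (Matrix.specialUnitaryGroup (Fin 2) ℂ).subtype ((layers.foldr (fun Ly (F : GaugeConfig d L (Matrix.specialUnitaryGroup (Fin 2) ℂ) ≃ᵐ GaugeConfig d L (Matrix.specialUnitaryGroup (Fin 2) ℂ)) => Ly.1.trans F) (MeasurableEquiv.refl (GaugeConfig d L (Matrix.specialUnitaryGroup (Fin 2) ℂ)))) ((fun l : Edge d L => expPauli (a l)) * V)) - Real.log ((layers.foldr (fun Ly K => fun v => Ly.2 v * K (Ly.1 v)) (fun _ => (1 : ℝ))) ((fun l : Edge d L => expPauli (a l)) * V))) 0 (Pi.single l (EuclideanSpace.single i (1 : ℝ))))) ∧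
      (∀ (V : GaugeConfig d L (Matrix.specialUnitaryGroup (Fin 2) ℂ)) (l : Edge d L),
        ‖(fun (V : GaugeConfig d L (Matrix.specialUnitaryGroup (Fin 2) ℂ)) (l : Edge d L) => κ • WithLp.toLp 2 (fun i : Fin 3 =>
        fderiv ℝ (fun a : Edge d L → EuclideanSpace ℝ (Fin 3) => β * wilsonAction (Matrix.specialUnitaryGroup (Fin 2) ℂ).subtype ((layers.foldr (fun Ly (F : GaugeConfig d L (Matrix.specialUnitaryGroup (Fin 2) ℂ) ≃ᵐ GaugeConfig d L (Matrix.specialUnitaryGroup (Fin 2) ℂ)) => Ly.1.trans F) (MeasurableEquiv.refl (GaugeConfig d L (Matrix.specialUnitaryGroup (Fin 2) ℂ)))) ((fun l : Edge d L => expPauli (a l)) * V)) - Real.log ((layers.foldr (fun Ly K => fun v => Ly.2 v * K (Ly.1 v)) (fun _ => (1 : ℝ))) ((fun l : Edge d L => expPauli (a l)) * V))) 0 (Pi.single l (EuclideanSpace.single i (1 : ℝ))))) V l‖ ≤ Φmax) ∧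
      (∀ V V' : GaugeConfig d L (Matrix.specialUnitaryGroup (Fin 2) ℂ),
        ‖(fun (V : GaugeConfig d L (Matrix.specialUnitaryGroup (Fin 2) ℂ)) (l : Edge d L) => κ • WithLp.toLp 2 (fun i : Fin 3 =>
        fderiv ℝ (fun a : Edge d L → EuclideanSpace ℝ (Fin 3) => β * wilsonAction (Matrix.specialUnitaryGroup (Fin 2) ℂ).subtype ((layers.foldr (fun Ly (F : GaugeConfig d L (Matrix.specialUnitaryGroup (Fin 2) ℂ) ≃ᵐ GaugeConfig d L (Matrix.specialUnitaryGroup (Fin 2) ℂ)) => Ly.1.trans F) (MeasurableEquiv.refl (GaugeConfig d L (Matrix.specialUnitaryGroup (Fin 2) ℂ)))) ((fun l : Edge d L => expPauli (a l)) * V)) - Real.log ((layers.foldr (fun Ly K => fun v => Ly.2 v * K (Ly.1 v)) (fun _ => (1 : ℝ))) ((fun l : Edge d L => expPauli (a l)) * V))) 0 (Pi.single l (EuclideanSpace.single i (1 : ℝ))))) V -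
          (fun (V : GaugeConfig d L (Matrix.specialUnitaryGroup (Fin 2) ℂ)) (l : Edge d L) => κ • WithLp.toLp 2 (fun i : Fin 3 =>
        fderiv ℝ (fun a : Edge d L → EuclideanSpace ℝ (Fin 3) => β * wilsonAction (Matrix.specialUnitaryGroup (Fin 2) ℂ).subtype ((layers.foldr (fun Ly (F : GaugeConfig d L (Matrix.specialUnitaryGroup (Fin 2) ℂ) ≃ᵐ GaugeConfig d L (Matrix.specialUnitaryGroup (Fin 2) ℂ)) => Ly.1.trans F) (MeasurableEquiv.refl (GaugeConfig d L (Matrix.specialUnitaryGroup (Fin 2) ℂ)))) ((fun l : Edge d L => expPauli (a l)) * V)) - Real.log ((layers.foldr (fun Ly K => fun v => Ly.2 v * K (Ly.1 v)) (fun _ => (1 : ℝ))) ((fun l : Edge d L => expPauli (a l)) * V))) 0 (Pi.single l (EuclideanSpace.single i (1 : ℝ))))) V'‖ ≤ KΦ * ‖coeConfig V - coeConfig V'‖) := by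
  have hw1 : 1 < w := Fact.out
  -- the reference torus of side `L₁ = w (2R + 1)`, `R = 2K + 2`
  haveI : NeZero (w*(2*(0+2*sched.length+2)+1)) := ⟨mul_ne_zero (by omega) (by omega)⟩
  have hwL₁ : w ∣ (w*(2*(0+2*sched.length+2)+1)) := Dvd.intro _ rfl
  have hR : 2 * (0 + 2 * sched.length + 2) < (w*(2*(0+2*sched.length+2)+1)) :=
    lt_of_lt_of_le (Nat.lt_succ_self _) (Nat.le_mul_of_pos_left _ (by omega))
  have hχ₁ : ∀ (x : Site d (w*(2*(0+2*sched.length+2)+1))) (i : Fin d),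
      ZMod.castHom hwL₁ (ZMod w) (∑ j, (Site.shift x i) j) ≠ ZMod.castHom hwL₁ (ZMod w) (∑ j, x j) :=
    fun x i => phaseMask_proper hwL₁ x i
  obtain ⟨layers₁, hmap₁, hpos₁, -, -⟩ := exists_layers_su2WilsonFlowLO
    (fun x : Site d (w*(2*(0+2*sched.length+2)+1)) => ZMod.castHom hwL₁ (ZMod w) (∑ j, x j)) hχ₁ hε sched
  obtain ⟨-, Φmax, KΦ, hΦ0, hK0, hb₁, hK₁⟩ := su2WilsonFlowLO_exactForce_regular
    (fun x : Site d (w*(2*(0+2*sched.length+2)+1)) => ZMod.castHom hwL₁ (ZMod w) (∑ j, x j)) ε sched layers₁ hmap₁ hpos₁ β κ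
  refine ⟨Φmax, KΦ, hΦ0, hK0, fun L _ hwL layers hmap hpos => ?_⟩
  obtain ⟨hΦm, -⟩ := su2WilsonFlowLO_exactForce_regular
    (fun x : Site d L => ZMod.castHom hwL (ZMod w) (∑ j, x j)) ε sched layers hmap hpos β κ
  -- the big torus `L·L₁` and its phase mask
  haveI : NeZero (L * (w*(2*(0+2*sched.length+2)+1))) :=
    ⟨mul_ne_zero (NeZero.ne L) (NeZero.ne (w*(2*(0+2*sched.length+2)+1)))⟩
  have hwM : w ∣ L * (w*(2*(0+2*sched.length+2)+1)) := Dvd.dvd.mul_right hwL _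
  have hχM : ∀ (x : Site d (L * (w*(2*(0+2*sched.length+2)+1)))) (i : Fin d),
      ZMod.castHom hwM (ZMod w) (∑ j, (Site.shift x i) j) ≠ ZMod.castHom hwM (ZMod w) (∑ j, x j) :=
    fun x i => phaseMask_proper hwM x i
  obtain ⟨layersM, hmapM, hposM, -, -⟩ := exists_layers_su2WilsonFlowLO
    (fun x : Site d (L * (w*(2*(0+2*sched.length+2)+1))) => ZMod.castHom hwM (ZMod w) (∑ j, x j)) hχM hε sched
  have hχ1 : ∀ x : Site d (L * (w*(2*(0+2*sched.length+2)+1))),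
      ZMod.castHom hwM (ZMod w) (∑ j, x j) =
        ZMod.castHom hwL (ZMod w) (∑ j, (ZMod.castHom (dvd_mul_right L (w*(2*(0+2*sched.length+2)+1))) (ZMod L)) (x j)) :=
    fun x => phaseMask_pull hwM hwL _ x
  have hχ2 : ∀ x : Site d (L * (w*(2*(0+2*sched.length+2)+1))),
      ZMod.castHom hwM (ZMod w) (∑ j, x j) =
        ZMod.castHom hwL₁ (ZMod w) (∑ j, (ZMod.castHom (dvd_mul_left (w*(2*(0+2*sched.length+2)+1)) L)
          (ZMod (w*(2*(0+2*sched.length+2)+1)))) (x j)) :=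
    fun x => phaseMask_pull hwM hwL₁ _ x
  have htr := fun (V : GaugeConfig d L (Matrix.specialUnitaryGroup (Fin 2) ℂ)) (l : Edge d L) =>
    su2WilsonFlowLO_exactForce_transplant
      (fun x : Site d L => ZMod.castHom hwL (ZMod w) (∑ j, x j))
      (fun x : Site d (w*(2*(0+2*sched.length+2)+1)) => ZMod.castHom hwL₁ (ZMod w) (∑ j, x j))
      (fun x : Site d (L * (w*(2*(0+2*sched.length+2)+1))) => ZMod.castHom hwM (ZMod w) (∑ j, x j))
      hχ1 hχ2 ε sched layers layers₁ layersM hmap hmap₁ hmapM hposM hR β κ V l l.1 rfl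
  refine ⟨hΦm, fun V l => ?_, fun V V' => ?_⟩
  · rw [htr V l]
    exact hb₁ _ _
  · set Φ₁ := (fun (V : GaugeConfig d (w*(2*(0+2*sched.length+2)+1)) (Matrix.specialUnitaryGroup (Fin 2) ℂ)) (l : Edge d (w*(2*(0+2*sched.length+2)+1))) => κ • WithLp.toLp 2 (fun i : Fin 3 =>
        fderiv ℝ (fun a : Edge d (w*(2*(0+2*sched.length+2)+1)) → EuclideanSpace ℝ (Fin 3) => β * wilsonAction (Matrix.specialUnitaryGroup (Fin 2) ℂ).subtype ((layers₁.foldr (fun Ly (F : GaugeConfig d (w*(2*(0+2*sched.length+2)+1)) (Matrix.specialUnitaryGroup (Fin 2) ℂ) ≃ᵐ GaugeConfig d (w*(2*(0+2*sched.length+2)+1)) (Matrix.specialUnitaryGroup (Fin 2) ℂ)) => Ly.1.trans F) (MeasurableEquiv.refl (GaugeConfig d (w*(2*(0+2*sched.length+2)+1)) (Matrix.specialUnitaryGroup (Fin 2) ℂ)))) ((fun l : Edge d (w*(2*(0+2*sched.length+2)+1)) => expPauli (a l)) * V)) - Real.log ((layers₁.foldr (fun Ly K => fun v => Ly.2 v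 * K (Ly.1 v)) (fun _ => (1 : ℝ))) ((fun l : Edge d (w*(2*(0+2*sched.length+2)+1)) => expPauli (a l)) * V))) 0 (Pi.single l (EuclideanSpace.single i (1 : ℝ))))) with hΦ₁
    have key : ∀ (f g : Edge d (w*(2*(0+2*sched.length+2)+1)) → EuclideanSpace ℝ (Fin 3))
        (i : Edge d (w*(2*(0+2*sched.length+2)+1))), ‖f i - g i‖ ≤ ‖f - g‖ :=
      fun f g i => norm_le_pi_norm (f - g) i
    refine (pi_norm_le_iff_of_nonneg (by positivity)).2 fun l => ?_
    rw [Pi.sub_apply, htr V l, htr V' l]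
    exact ((key _ _ _).trans (hK₁ _ _)).trans (mul_le_mul_of_nonneg_left (norm_transplant_sub_le l.1 _ V V') hK0)

end Uniform

end Summit.Ventures.LatticeQCDFlow.Exactness
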